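import Summits.QuantumFields.BalabanUV.Beta.GAN24.T2RecChargeStep

/-!
# `BalabanUV.Beta.GAN24.T2RecChargeStepMap` — binder row G-an2-4 ∕ (CONV-C), CT-W (F2) ∕ (R-DEV): **THE ONE-STEP CHARGE LAWS OF THE DRESSED AND OF THE
# REFERENCE (UNDRESSED-KERNEL, COMB-TABLE) SECOND-ORDER STEPS, READ AS AFFINE MAPS ON AN ARBITRARY INPUT TABLE** — Part 2 of `T2RecChargeStep`
# (whose §2 is the instance `X = T̃_j`): for every jointly `Lc`-covariant `LocStencil₂` table `X`,
# `zmode N (𝒜^E_j X + b̃_j) = zmode N b̃_j + λ̂·(zmode Lc (𝔇X) (μν) + (νμ))` and `zmode N (𝒜^B_j X + b^B_j) = zmode N b^B_j + λ̂·(zmode Lc X (μν) + (νμ))`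

NOT IN PRINT; OUR BOOKKEEPING (road-P2 chair of row G-an2-4, unit `b2b-balaban-gan24-p2` gen 36, crux team (2); journal [GAN24P2-G36-INTENT1] ∕ W-9e).
HONEST FRAMING (cell contract, verbatim): «discharging `BetaPertH` makes Bałaban's UV stability UNCONDITIONAL — a real constructive-QFT result; it is
NOT the continuum limit and NOT the Clay problem.»  HONEST DEPENDENCY (verbatim): «continuum YM on T⁴ ⇐ BetaPertH ∧ nine spine estimates (0/9 proved);
BetaPertH ⇐ (D1) ∧ (D4) ∧ CAP+tail; G-an2-4 gates asym, D1 and NE2/3/4.»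

WHY (the located use).  The OWNER gan24-p1 g23's route of record (R-DEV) (RULING R-gan24p1-g23-1, `T2DeviationTower`) runs the DEVIATION `D_j := T̃_j − T_j` of
an2's dressed comb tower `T̃_j` from the REFERENCE tower `T_j := unitS₂_j (T2RecOf d Lc (KInvStep Lc ·) (SpureRecAt ρ …) (M1At ρ cΛ) cE₂ cB Tc vh₂S (mixFFAt ρ Lc) j)`
(undressed K-slot, comb first-order tables): `D_{j+1} = 𝒜^E_j D_j + g′_j`, `g′_j := (𝒜^E_j − 𝒜^B_j) T_j + (b̃_j − b^B_j)`.  Its charge rows — (Z′)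
`ZfreeSym (g′_j)`, leaf-06 g43's (★) `zmodeSym (D_{j+1}) = λ̂·zmodeSym_{Lc}(𝔇 D_j) + zmodeSym (g′_j)`, the conservation criterion of Part 1 §3, leaf-03's
(R-GRW) source row — are ALL instances of the two affine-map laws below at `X = T_j`, `X = D_j`, `X = T̃_j` (the maps are affine, `zmode` is additive on
`LocStencil₂` tables).  NOTATION as in Part 1 (`λ̂ := N^{d+1}·(cE₂·Lc^{2(d+1)})·½·Lc^{−4(d+2)}`; `b^B_j` = the reference tower's `T`-free source = the same
bracket through `K♮_j = unitK_j (KInvStep Lc j)` with the COMB tables).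

WHAT (generic `d`, in-block root, every `j`, every `N`, all constants symbolic, NO pin; generic OFF-DIAGONAL `LocStencil₂` border; [folklore] composition BY
NAME; 0 `def`, 0 cite, 0 `def … : Prop`, 0 sorry):
* `shape_source` — the dressed source `b̃_j` is `LocStencil₂` (as `T̃_{j+1} − 𝒜^B_j (𝔇 T̃_j)`, Part 1 §1); `succ_eq_lin4_add_B` — the reference tower's affine step
  `T_{j+1} = 𝒜^B_j T_j + b^B_j` (my `T2RecOfUnitSplit.unitS₂_T2RecOf_succ_eq_lin4_add` at `G := KInvStep`, letters `decays_KInvStep`, `locStencil_SpureRecAt`,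
  `vertexFamily_M1At`, `hmix_an1`); `shape_memberB`, `shape_sourceB`.
* **`zmode_stepE_eq (X)`** — `zmode N (fun κ u κ′ u′ ↦ 𝒜^E_j X κ u κ′ u′ + b̃_j κ u κ′ u′) (μ,ν;α,β) = zmode N b̃_j (μ,ν;α,β) + λ̂·(zmode Lc (𝔇X) (μ,ν;α,β) +
  zmode Lc (𝔇X) (ν,μ;α,β))` (leaf-06's `lin4_comb_coDressKBmAt` + `Lin4ZeroMode.zmode_lin4_step` on `𝔇X` + `zmode_add`).
* **`zmode_stepB_eq (X)`** — `zmode N (fun κ u κ′ u′ ↦ 𝒜^B_j X κ u κ′ u′ + b^B_j κ u κ′ u′) (μ,ν;α,β) = zmode N b^B_j (μ,ν;α,β) + λ̂·(zmode Lc X (μ,ν;α,β) +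
  zmode Lc X (ν,μ;α,β))`.
READING (docstring level, not asserted): subtracting the two at `X = T_j` gives the charge of the (R-DEV) forcing,
`zmodeSym (g′_j) = [zmodeSym b̃_j − zmodeSym b^B_j] + 2λ̂·[zmodeSym_{Lc}(𝔇 T_j) − zmodeSym_{Lc}(T_j)]`; with leaf-02 g52's `zmode_Lc ∘ 𝔇 = Lc⁴·fourFace_Lc`
the bracket is the FOUR-FACE DEFECT of the reference member — so (Z′) ∧ F2a-comb ∧ conservation of `T̃` force `Lc⁴·fourFaceSym (D_j) = zmodeSym (D_j)` at
every level (journal W-9c).  Asserts NO value of Bałaban's tables; discharges NOTHING of (Z′), (F2), «T2Shape», «T2Drift», (hW, hWall); NEVER «G-an2-4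
closed» as (CONV-C); NOT D1, NOT BetaPertH, NOT continuum, NOT Clay.  2026-08-22.
-/

noncomputable section

open Finset
open scoped BigOperators
open Literature.MathematicalPhysics.QuantumFieldTheory
open Literature.MathematicalPhysics.QuantumFieldTheory.Balaban1983to89
open Literature.MathematicalPhysics.QuantumFieldTheory.Balaban1983to89.Beta
open ExpKernelCalculus (MKer Decays shiftK)
open OneStepResolventKernel (Fib decays_mono)
open OneStepKernelFamily (KInvStep decays_KInvStep)
open AffineAveraging (box toSite)
open BalabanCompositeJets (LocStencil₂)
open SecondOrderResponse (W2SymOfK LocStencilFM)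
open BalabanStepJetsSucc (mmRead)
open BalabanStepW2 (K3OfK M2Of locStencil₂_add' locStencil₂_smul')
open AveragingMixedJetTables (mixFFAt)
open Summit.QuantumFields.BalabanUV.Beta.HessKerDressedUnits (unitK unitS decays_unitK)
open Summit.QuantumFields.BalabanUV.Beta.SecondOrderUnits (unitM unitS₂ unitM₂)
open Summit.QuantumFields.BalabanUV.Beta.AxialDressingRooted (coProjBmAtK coDressKBmAt dressKBmAt decays_coDressKBmAt_KInvStep)
open Summit.QuantumFields.BalabanUV.Beta.SpineRooted (T2RecOf T2RecAt SpureRecAt M1At T2RecOf_loc locStencil_SpureRecAt vertexFamily_M1At)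
open Summit.QuantumFields.BalabanUV.Beta.MixedJetTablesPlug (hmix_an1)
open Summit.QuantumFields.BalabanUV.Beta.GAN24.CombesThomas (sfStep smStep)
open Summit.QuantumFields.BalabanUV.Beta.GAN24.T2RecursionAffine (lin4)
open Summit.QuantumFields.BalabanUV.Beta.GAN24.BiStencilZeroMode (Tab zmode)
open Summit.QuantumFields.BalabanUV.Beta.GAN24.WSlotFirstDiff (locStencil₂_unitS₂ zmode_add)
open Summit.QuantumFields.BalabanUV.Beta.GAN24.Lin4ZeroMode (locStencil₂_lin4 zmode_lin4_step)
open Summit.QuantumFields.BalabanUV.Beta.GAN24.LinT2CoDressedStep (lin4_comb_coDressKBmAt translate_dress)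
open Summit.QuantumFields.BalabanUV.Beta.GAN24.T2RecOfUnitSplit (unitS₂_T2RecOf_succ_eq_lin4_add step_data_of_letters)
open Summit.QuantumFields.BalabanUV.Beta.GAN24.T2RecChargeStep (shape_member shape_dress succ_eq_lin4_dress_add)

namespace Summit.QuantumFields.BalabanUV.Beta.GAN24.T2RecChargeStepMap

variable {d : ℕ} {Lc : ℕ} [NeZero Lc] {r : Fin (d + 1) → ℕ}

/-! ## §1 Sources and the reference tower's step -/

/-- [folklore] **THE DRESSED COMB SOURCE `b̃_j` IS `LocStencil₂`** (as the difference `T̃_{j+1} − 𝒜^B_j (𝔇 T̃_j)` of two `LocStencil₂` tables, §1;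
existential constant and rate). -/
theorem shape_source (hLc : 1 ≤ Lc) (hr : r ∈ box (d + 1) Lc) (cE cVH cΛ cE₂ cB : ℝ) (Tc : Fin 4 → Fin 4 → Fin 4 → Fin 4 → ℝ)
    {vh₂S : Tab d} (hBff : ∀ κ u κ' u' x z (α β : Fin (d + 1)), vh₂S κ u κ' u' x z (Sum.inl α) (Sum.inl β) = 0)
    (hBmm : ∀ κ u κ' u' x z (μ ν : Fin (d + 1)), vh₂S κ u κ' u' x z (Sum.inr μ) (Sum.inr ν) = 0)
    (hB : ∃ C δ : ℝ, 0 < δ ∧ LocStencil₂ vh₂S C δ) (j : ℕ) :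
    ∃ Cb δb : ℝ, 0 < δb ∧ LocStencil₂ (fun κ u κ' u' => (cE₂ * (Lc : ℝ) ^ (2 * (d + 1))) • mmRead Lc (K3OfK
            (unitK (sfStep Lc j) (smStep d Lc j) (coDressKBmAt (toSite r) Lc (KInvStep (d := d) Lc j))) Lc
            (unitS (sfStep Lc j) (smStep d Lc j) (SpureRecAt d Lc (toSite r) cE cVH cΛ j)) (unitM (sfStep Lc j) (smStep d Lc j) (M1At d Lc (toSite r) cΛ j))
            (W2SymOfK (unitK (sfStep Lc j) (smStep d Lc j) (coDressKBmAt (toSite r) Lc (KInvStep (d := d) Lc j))) Lc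
              (unitS (sfStep Lc j) (smStep d Lc j) (SpureRecAt d Lc (toSite r) cE cVH cΛ j)) (unitM (sfStep Lc j) (smStep d Lc j) (M1At d Lc (toSite r) cΛ j)) 0
              (unitM₂ (sfStep Lc j) (smStep d Lc j) (M2Of d Lc (mixFFAt (toSite r) Lc) j))) κ u κ' u') + cB • vh₂S κ u κ' u') Cb δb := by
  have hstep := succ_eq_lin4_dress_add hLc hr cE cVH cΛ cE₂ cB Tc hBff hBmm hB j
  obtain ⟨CT, δT, hδT, hT⟩ := shape_member hLc hr cE cVH cΛ cE₂ cB Tc hB j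
  obtain ⟨C1, δ1, hδ1, hT1⟩ := shape_member hLc hr cE cVH cΛ cE₂ cB Tc hB (j + 1)
  obtain ⟨CD, hD⟩ := shape_dress hLc hr hT hδT.le
  obtain ⟨m, CK, hm, hCK, hK⟩ := decays_KInvStep (d := d) (Lc := Lc) j
  have hA := locStencil₂_lin4 (decays_unitK (sf := sfStep Lc j) (sm := smStep d Lc j) hK) (by positivity) hm hLc
    (cE₂ * (Lc : ℝ) ^ (2 * (d + 1))) hD hδT
  have hr0 : 0 < min δ1 (min m δT / 128) := lt_min hδ1 (by positivity)
  have hb : (fun κ u κ' u' => (cE₂ * (Lc : ℝ) ^ (2 * (d + 1))) • mmRead Lc (K3OfK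
            (unitK (sfStep Lc j) (smStep d Lc j) (coDressKBmAt (toSite r) Lc (KInvStep (d := d) Lc j))) Lc
            (unitS (sfStep Lc j) (smStep d Lc j) (SpureRecAt d Lc (toSite r) cE cVH cΛ j)) (unitM (sfStep Lc j) (smStep d Lc j) (M1At d Lc (toSite r) cΛ j))
            (W2SymOfK (unitK (sfStep Lc j) (smStep d Lc j) (coDressKBmAt (toSite r) Lc (KInvStep (d := d) Lc j))) Lc
              (unitS (sfStep Lc j) (smStep d Lc j) (SpureRecAt d Lc (toSite r) cE cVH cΛ j)) (unitM (sfStep Lc j) (smStep d Lc j) (M1At d Lc (toSite r) cΛ j)) 0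
              (unitM₂ (sfStep Lc j) (smStep d Lc j) (M2Of d Lc (mixFFAt (toSite r) Lc) j))) κ u κ' u') + cB • vh₂S κ u κ' u')
      = fun κ u κ' u' =>
          unitS₂ (sfStep Lc (j + 1)) (smStep d Lc (j + 1)) (T2RecAt d Lc (toSite r) cE cVH cΛ cE₂ cB Tc vh₂S (mixFFAt (toSite r) Lc) (j + 1)) κ u κ' u'
        + (-1 : ℝ) • lin4 (cE₂ * (Lc : ℝ) ^ (2 * (d + 1))) (unitK (sfStep Lc j) (smStep d Lc j) (KInvStep (d := d) Lc j)) Lc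
            (fun κ u κ' u' => dressKBmAt (toSite r) Lc (coProjBmAtK (toSite r) Lc (fun κ₁ u₁ => coProjBmAtK (toSite r) Lc
              (unitS₂ (sfStep Lc j) (smStep d Lc j) (T2RecAt d Lc (toSite r) cE cVH cΛ cE₂ cB Tc vh₂S (mixFFAt (toSite r) Lc) j) κ₁ u₁) κ' u') κ u))
            κ u κ' u' := by
    rw [hstep]
    funext κ u κ' u'
    simp only [Pi.add_apply, neg_one_smul]
    abel
  have key := locStencil₂_add' (hT1.mono (min_le_left _ _)) (locStencil₂_smul' (-1) (hA.mono (min_le_right _ _)))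
  rw [← hb] at key
  exact ⟨_, _, hr0, key⟩

/-- [folklore] **THE REFERENCE (UNDRESSED-KERNEL, COMB-TABLE) TOWER's STEP AND SOURCE**: with `T_j := unitS₂_j (T2RecOf d Lc (KInvStep Lc ·) (SpureRecAt ρ …)
(M1At ρ cΛ) cE₂ cB Tc vh₂S (mixFFAt ρ Lc) j)` (the OWNER's (R-DEV) base tower) and `b^B_j` its `T`-free part (the bracket through `K♮_j` with the COMB tables),
`T_{j+1} = 𝒜^B_j T_j + b^B_j` (my `unitS₂_T2RecOf_succ_eq_lin4_add` at `G := KInvStep`, letters `decays_KInvStep`, `locStencil_SpureRecAt`, `vertexFamily_M1At`,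
`hmix_an1`) and `b^B_j` is `LocStencil₂`. -/
theorem succ_eq_lin4_add_B (hLc : 1 ≤ Lc) (hr : r ∈ box (d + 1) Lc) (cE cVH cΛ cE₂ cB : ℝ) (Tc : Fin 4 → Fin 4 → Fin 4 → Fin 4 → ℝ)
    {vh₂S : Tab d} (hBff : ∀ κ u κ' u' x z (α β : Fin (d + 1)), vh₂S κ u κ' u' x z (Sum.inl α) (Sum.inl β) = 0)
    (hBmm : ∀ κ u κ' u' x z (μ ν : Fin (d + 1)), vh₂S κ u κ' u' x z (Sum.inr μ) (Sum.inr ν) = 0)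
    (hB : ∃ C δ : ℝ, 0 < δ ∧ LocStencil₂ vh₂S C δ) (j : ℕ) :
    unitS₂ (sfStep Lc (j + 1)) (smStep d Lc (j + 1)) (T2RecOf d Lc (fun j => KInvStep (d := d) Lc j) (SpureRecAt d Lc (toSite r) cE cVH cΛ)
        (M1At d Lc (toSite r) cΛ) cE₂ cB Tc vh₂S (mixFFAt (toSite r) Lc) (j + 1))
      = lin4 (cE₂ * (Lc : ℝ) ^ (2 * (d + 1))) (unitK (sfStep Lc j) (smStep d Lc j) (KInvStep (d := d) Lc j)) Lc
          (unitS₂ (sfStep Lc j) (smStep d Lc j) (T2RecOf d Lc (fun j => KInvStep (d := d) Lc j) (SpureRecAt d Lc (toSite r) cE cVH cΛ)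
            (M1At d Lc (toSite r) cΛ) cE₂ cB Tc vh₂S (mixFFAt (toSite r) Lc) j))
        + (fun κ u κ' u' => (cE₂ * (Lc : ℝ) ^ (2 * (d + 1))) • mmRead Lc (K3OfK
            (unitK (sfStep Lc j) (smStep d Lc j) (KInvStep (d := d) Lc j)) Lc
            (unitS (sfStep Lc j) (smStep d Lc j) (SpureRecAt d Lc (toSite r) cE cVH cΛ j)) (unitM (sfStep Lc j) (smStep d Lc j) (M1At d Lc (toSite r) cΛ j))
            (W2SymOfK (unitK (sfStep Lc j) (smStep d Lc j) (KInvStep (d := d) Lc j)) Lc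
              (unitS (sfStep Lc j) (smStep d Lc j) (SpureRecAt d Lc (toSite r) cE cVH cΛ j)) (unitM (sfStep Lc j) (smStep d Lc j) (M1At d Lc (toSite r) cΛ j)) 0
              (unitM₂ (sfStep Lc j) (smStep d Lc j) (M2Of d Lc (mixFFAt (toSite r) Lc) j))) κ u κ' u') + cB • vh₂S κ u κ' u') := by
  obtain ⟨C, δ, C₀, C₁, hδ, hK, h₀, hW⟩ := step_data_of_letters (fun j => KInvStep (d := d) Lc j)
      (SpureRecAt d Lc (toSite r) cE cVH cΛ) (M1At d Lc (toSite r) cΛ) cE₂ cB Tc hLc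
      (fun j => decays_KInvStep (d := d) (Lc := Lc) j) (fun j => locStencil_SpureRecAt hLc hr cE cVH cΛ j)
      (fun j => ⟨_, 1, one_pos, vertexFamily_M1At hLc hr cΛ j zero_le_one⟩) hB (hmix_an1 hLc hr) j
  exact unitS₂_T2RecOf_succ_eq_lin4_add (fun j => KInvStep (d := d) Lc j)
      (SpureRecAt d Lc (toSite r) cE cVH cΛ) (M1At d Lc (toSite r) cΛ) cE₂ cB Tc vh₂S (mixFFAt (toSite r) Lc) hBff hBmm j hδ hK h₀ hW

/-- [folklore] **EVERY MEMBER OF THE REFERENCE TOWER IS `LocStencil₂`** (an2's `T2RecOf_loc` + `locStencil₂_unitS₂`). -/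
theorem shape_memberB (hLc : 1 ≤ Lc) (hr : r ∈ box (d + 1) Lc) (cE cVH cΛ cE₂ cB : ℝ) (Tc : Fin 4 → Fin 4 → Fin 4 → Fin 4 → ℝ)
    {vh₂S : Tab d} (hB : ∃ C δ : ℝ, 0 < δ ∧ LocStencil₂ vh₂S C δ) (j : ℕ) :
    ∃ CT δT : ℝ, 0 < δT ∧ LocStencil₂ (unitS₂ (sfStep Lc j) (smStep d Lc j)
      (T2RecOf d Lc (fun j => KInvStep (d := d) Lc j) (SpureRecAt d Lc (toSite r) cE cVH cΛ)
        (M1At d Lc (toSite r) cΛ) cE₂ cB Tc vh₂S (mixFFAt (toSite r) Lc) j)) CT δT := by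
  obtain ⟨C, δ, hδ, h⟩ := T2RecOf_loc cE₂ cB Tc vh₂S (mixFFAt (toSite r) Lc) hLc (fun j => decays_KInvStep (d := d) (Lc := Lc) j)
    (fun j => locStencil_SpureRecAt hLc hr cE cVH cΛ j) (fun j => ⟨_, 1, one_pos, vertexFamily_M1At hLc hr cΛ j zero_le_one⟩) hB (hmix_an1 hLc hr) j
  exact ⟨_, δ, hδ, locStencil₂_unitS₂ (sfStep Lc j) (smStep d Lc j) h⟩

/-- [folklore] **THE REFERENCE TOWER's SOURCE `b^B_j` IS `LocStencil₂`** (difference of two `LocStencil₂` tables). -/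
theorem shape_sourceB (hLc : 1 ≤ Lc) (hr : r ∈ box (d + 1) Lc) (cE cVH cΛ cE₂ cB : ℝ) (Tc : Fin 4 → Fin 4 → Fin 4 → Fin 4 → ℝ)
    {vh₂S : Tab d} (hBff : ∀ κ u κ' u' x z (α β : Fin (d + 1)), vh₂S κ u κ' u' x z (Sum.inl α) (Sum.inl β) = 0)
    (hBmm : ∀ κ u κ' u' x z (μ ν : Fin (d + 1)), vh₂S κ u κ' u' x z (Sum.inr μ) (Sum.inr ν) = 0)
    (hB : ∃ C δ : ℝ, 0 < δ ∧ LocStencil₂ vh₂S C δ) (j : ℕ) :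
    ∃ Cb δb : ℝ, 0 < δb ∧ LocStencil₂ (fun κ u κ' u' => (cE₂ * (Lc : ℝ) ^ (2 * (d + 1))) • mmRead Lc (K3OfK
            (unitK (sfStep Lc j) (smStep d Lc j) (KInvStep (d := d) Lc j)) Lc
            (unitS (sfStep Lc j) (smStep d Lc j) (SpureRecAt d Lc (toSite r) cE cVH cΛ j)) (unitM (sfStep Lc j) (smStep d Lc j) (M1At d Lc (toSite r) cΛ j))
            (W2SymOfK (unitK (sfStep Lc j) (smStep d Lc j) (KInvStep (d := d) Lc j)) Lc
              (unitS (sfStep Lc j) (smStep d Lc j) (SpureRecAt d Lc (toSite r) cE cVH cΛ j)) (unitM (sfStep Lc j) (smStep d Lc j) (M1At d Lc (toSite r) cΛ j)) 0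
              (unitM₂ (sfStep Lc j) (smStep d Lc j) (M2Of d Lc (mixFFAt (toSite r) Lc) j))) κ u κ' u') + cB • vh₂S κ u κ' u') Cb δb := by
  have hstep := succ_eq_lin4_add_B hLc hr cE cVH cΛ cE₂ cB Tc hBff hBmm hB j
  obtain ⟨CT, δT, hδT, hT⟩ := shape_memberB hLc hr cE cVH cΛ cE₂ cB Tc hB j
  obtain ⟨C1, δ1, hδ1, hT1⟩ := shape_memberB hLc hr cE cVH cΛ cE₂ cB Tc hB (j + 1)
  obtain ⟨m, CK, hm, hCK, hK⟩ := decays_KInvStep (d := d) (Lc := Lc) j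
  have hA := locStencil₂_lin4 (decays_unitK (sf := sfStep Lc j) (sm := smStep d Lc j) hK) (by positivity) hm hLc
    (cE₂ * (Lc : ℝ) ^ (2 * (d + 1))) hT hδT
  have hr0 : 0 < min δ1 (min m δT / 128) := lt_min hδ1 (by positivity)
  have hb : (fun κ u κ' u' => (cE₂ * (Lc : ℝ) ^ (2 * (d + 1))) • mmRead Lc (K3OfK
            (unitK (sfStep Lc j) (smStep d Lc j) (KInvStep (d := d) Lc j)) Lc
            (unitS (sfStep Lc j) (smStep d Lc j) (SpureRecAt d Lc (toSite r) cE cVH cΛ j)) (unitM (sfStep Lc j) (smStep d Lc j) (M1At d Lc (toSite r) cΛ j))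
            (W2SymOfK (unitK (sfStep Lc j) (smStep d Lc j) (KInvStep (d := d) Lc j)) Lc
              (unitS (sfStep Lc j) (smStep d Lc j) (SpureRecAt d Lc (toSite r) cE cVH cΛ j)) (unitM (sfStep Lc j) (smStep d Lc j) (M1At d Lc (toSite r) cΛ j)) 0
              (unitM₂ (sfStep Lc j) (smStep d Lc j) (M2Of d Lc (mixFFAt (toSite r) Lc) j))) κ u κ' u') + cB • vh₂S κ u κ' u')
      = fun κ u κ' u' =>
          unitS₂ (sfStep Lc (j + 1)) (smStep d Lc (j + 1)) (T2RecOf d Lc (fun j => KInvStep (d := d) Lc j) (SpureRecAt d Lc (toSite r) cE cVH cΛ)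
            (M1At d Lc (toSite r) cΛ) cE₂ cB Tc vh₂S (mixFFAt (toSite r) Lc) (j + 1)) κ u κ' u'
        + (-1 : ℝ) • lin4 (cE₂ * (Lc : ℝ) ^ (2 * (d + 1))) (unitK (sfStep Lc j) (smStep d Lc j) (KInvStep (d := d) Lc j)) Lc
            (unitS₂ (sfStep Lc j) (smStep d Lc j) (T2RecOf d Lc (fun j => KInvStep (d := d) Lc j) (SpureRecAt d Lc (toSite r) cE cVH cΛ)
              (M1At d Lc (toSite r) cΛ) cE₂ cB Tc vh₂S (mixFFAt (toSite r) Lc) j)) κ u κ' u' := by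
    rw [hstep]
    funext κ u κ' u'
    simp only [Pi.add_apply, neg_one_smul]
    abel
  have key := locStencil₂_add' (hT1.mono (min_le_left _ _)) (locStencil₂_smul' (-1) (hA.mono (min_le_right _ _)))
  rw [← hb] at key
  exact ⟨_, _, hr0, key⟩

/-! ## §2 The two affine-map charge laws -/

/-- NOT IN PRINT; OUR BOOKKEEPING ([folklore]).  **THE DRESSED ONE-STEP CHARGE LAW FOR AN ARBITRARY INPUT TABLE**: for every `LocStencil₂` (rate `> 0`),
jointly `Lc`-covariant table `X`, every period `N`, every `j`:
`zmode N (𝒜^E_j X + b̃_j) (μ,ν;α,β) = zmode N b̃_j (μ,ν;α,β) + N^{d+1}·(cE₂·Lc^{2(d+1)})·½·Lc^{−4(d+2)}·(zmode Lc (𝔇X) (μ,ν;α,β) + zmode Lc (𝔇X) (ν,μ;α,β))`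
— the dressed step read as an affine MAP (leaf-06's `lin4_comb_coDressKBmAt` + `zmode_lin4_step` on `𝔇X` + `zmode_add`).  Instances: `X = T̃_j` (§2), `X = T_j`
(the reference member: with `zmode_stepB_eq` the charge of the OWNER's deviation forcing `g′_j`), `X = D_j` (leaf-06 g43's (★)). -/
theorem zmode_stepE_eq (hLc : 1 ≤ Lc) (hr : r ∈ box (d + 1) Lc) (cE cVH cΛ cE₂ cB : ℝ) (Tc : Fin 4 → Fin 4 → Fin 4 → Fin 4 → ℝ)
    {vh₂S : Tab d} (hBff : ∀ κ u κ' u' x z (α β : Fin (d + 1)), vh₂S κ u κ' u' x z (Sum.inl α) (Sum.inl β) = 0)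
    (hBmm : ∀ κ u κ' u' x z (μ ν : Fin (d + 1)), vh₂S κ u κ' u' x z (Sum.inr μ) (Sum.inr ν) = 0)
    (hB : ∃ C δ : ℝ, 0 < δ ∧ LocStencil₂ vh₂S C δ) {X : Tab d} {CX δX : ℝ} (hX : LocStencil₂ X CX δX) (hδX : 0 < δX)
    (hXcov : ∀ κ u κ' u' t, X κ (u + (Lc : ℤ) • t) κ' (u' + (Lc : ℤ) • t) = shiftK (-((Lc : ℤ) • t)) (X κ u κ' u'))
    (N j : ℕ) (μ ν α β : Fin (d + 1)) :
    zmode N (fun κ u κ' u' =>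
          lin4 (cE₂ * (Lc : ℝ) ^ (2 * (d + 1))) (unitK (sfStep Lc j) (smStep d Lc j) (coDressKBmAt (toSite r) Lc (KInvStep (d := d) Lc j))) Lc X κ u κ' u'
        + ((cE₂ * (Lc : ℝ) ^ (2 * (d + 1))) • mmRead Lc (K3OfK
            (unitK (sfStep Lc j) (smStep d Lc j) (coDressKBmAt (toSite r) Lc (KInvStep (d := d) Lc j))) Lc
            (unitS (sfStep Lc j) (smStep d Lc j) (SpureRecAt d Lc (toSite r) cE cVH cΛ j)) (unitM (sfStep Lc j) (smStep d Lc j) (M1At d Lc (toSite r) cΛ j))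
            (W2SymOfK (unitK (sfStep Lc j) (smStep d Lc j) (coDressKBmAt (toSite r) Lc (KInvStep (d := d) Lc j))) Lc
              (unitS (sfStep Lc j) (smStep d Lc j) (SpureRecAt d Lc (toSite r) cE cVH cΛ j)) (unitM (sfStep Lc j) (smStep d Lc j) (M1At d Lc (toSite r) cΛ j)) 0
              (unitM₂ (sfStep Lc j) (smStep d Lc j) (M2Of d Lc (mixFFAt (toSite r) Lc) j))) κ u κ' u') + cB • vh₂S κ u κ' u'))
        μ ν (Sum.inl α) (Sum.inl β)
      = zmode N (fun κ u κ' u' => (cE₂ * (Lc : ℝ) ^ (2 * (d + 1))) • mmRead Lc (K3OfK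
            (unitK (sfStep Lc j) (smStep d Lc j) (coDressKBmAt (toSite r) Lc (KInvStep (d := d) Lc j))) Lc
            (unitS (sfStep Lc j) (smStep d Lc j) (SpureRecAt d Lc (toSite r) cE cVH cΛ j)) (unitM (sfStep Lc j) (smStep d Lc j) (M1At d Lc (toSite r) cΛ j))
            (W2SymOfK (unitK (sfStep Lc j) (smStep d Lc j) (coDressKBmAt (toSite r) Lc (KInvStep (d := d) Lc j))) Lc
              (unitS (sfStep Lc j) (smStep d Lc j) (SpureRecAt d Lc (toSite r) cE cVH cΛ j)) (unitM (sfStep Lc j) (smStep d Lc j) (M1At d Lc (toSite r) cΛ j)) 0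
              (unitM₂ (sfStep Lc j) (smStep d Lc j) (M2Of d Lc (mixFFAt (toSite r) Lc) j))) κ u κ' u') + cB • vh₂S κ u κ' u')
          μ ν (Sum.inl α) (Sum.inl β)
        + ((N : ℝ) ^ (d + 1)) * ((cE₂ * (Lc : ℝ) ^ (2 * (d + 1))) * ((1 / 2 : ℝ) * (((Lc : ℝ) ^ (d + 1 + 1))⁻¹) ^ 4) *
          (zmode Lc (fun κ u κ' u' => dressKBmAt (toSite r) Lc (coProjBmAtK (toSite r) Lc (fun κ₁ u₁ => coProjBmAtK (toSite r) Lc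
              (X κ₁ u₁) κ' u') κ u)) μ ν (Sum.inl α) (Sum.inl β)
            + zmode Lc (fun κ u κ' u' => dressKBmAt (toSite r) Lc (coProjBmAtK (toSite r) Lc (fun κ₁ u₁ => coProjBmAtK (toSite r) Lc
              (X κ₁ u₁) κ' u') κ u)) ν μ (Sum.inl α) (Sum.inl β))) := by
  obtain ⟨Cb, δb, hδb, hb⟩ := shape_source hLc hr cE cVH cΛ cE₂ cB Tc hBff hBmm hB j
  obtain ⟨CD, hD⟩ := shape_dress hLc hr hX hδX.le
  have hDcov := translate_dress (toSite r) hLc hXcov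
  obtain ⟨m, CK, hm, hCK, hK⟩ := decays_KInvStep (d := d) (Lc := Lc) j
  have hA := locStencil₂_lin4 (decays_unitK (sf := sfStep Lc j) (sm := smStep d Lc j) hK) (by positivity) hm hLc
    (cE₂ * (Lc : ℝ) ^ (2 * (d + 1))) hD hδX
  have hr0 : 0 < min (min m δX / 128) δb := lt_min (by positivity) hδb
  rw [lin4_comb_coDressKBmAt hr j hX hδX (cE₂ * (Lc : ℝ) ^ (2 * (d + 1))),
    zmode_add (N := N) (hA.mono (min_le_left _ _)) (hb.mono (min_le_right _ _)) hr0,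
    zmode_lin4_step hLc N j (cE₂ * (Lc : ℝ) ^ (2 * (d + 1))) hD hδX hDcov μ ν α β]
  ring

/-- NOT IN PRINT; OUR BOOKKEEPING ([folklore]).  **THE UNDRESSED (REFERENCE) ONE-STEP CHARGE LAW FOR AN ARBITRARY INPUT TABLE**: for every `LocStencil₂`
jointly `Lc`-covariant `X`, `zmode N (𝒜^B_j X + b^B_j) (μ,ν;α,β) = zmode N b^B_j (μ,ν;α,β) + N^{d+1}·(cE₂·Lc^{2(d+1)})·½·Lc^{−4(d+2)}·(zmode Lc X (μ,ν;α,β) +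
zmode Lc X (ν,μ;α,β))` (`zmode_lin4_step` + `zmode_add`; `b^B_j` = the reference tower's source).  Subtracting from `zmode_stepE_eq` at the same `X` displays
the charge of the difference of the two affine maps — at `X = T_j` the OWNER's (R-DEV) forcing `g′_j`. -/
theorem zmode_stepB_eq (hLc : 1 ≤ Lc) (hr : r ∈ box (d + 1) Lc) (cE cVH cΛ cE₂ cB : ℝ) (Tc : Fin 4 → Fin 4 → Fin 4 → Fin 4 → ℝ)
    {vh₂S : Tab d} (hBff : ∀ κ u κ' u' x z (α β : Fin (d + 1)), vh₂S κ u κ' u' x z (Sum.inl α) (Sum.inl β) = 0)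
    (hBmm : ∀ κ u κ' u' x z (μ ν : Fin (d + 1)), vh₂S κ u κ' u' x z (Sum.inr μ) (Sum.inr ν) = 0)
    (hB : ∃ C δ : ℝ, 0 < δ ∧ LocStencil₂ vh₂S C δ) {X : Tab d} {CX δX : ℝ} (hX : LocStencil₂ X CX δX) (hδX : 0 < δX)
    (hXcov : ∀ κ u κ' u' t, X κ (u + (Lc : ℤ) • t) κ' (u' + (Lc : ℤ) • t) = shiftK (-((Lc : ℤ) • t)) (X κ u κ' u'))
    (N j : ℕ) (μ ν α β : Fin (d + 1)) :
    zmode N (fun κ u κ' u' =>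
          lin4 (cE₂ * (Lc : ℝ) ^ (2 * (d + 1))) (unitK (sfStep Lc j) (smStep d Lc j) (KInvStep (d := d) Lc j)) Lc X κ u κ' u'
        + ((cE₂ * (Lc : ℝ) ^ (2 * (d + 1))) • mmRead Lc (K3OfK
            (unitK (sfStep Lc j) (smStep d Lc j) (KInvStep (d := d) Lc j)) Lc
            (unitS (sfStep Lc j) (smStep d Lc j) (SpureRecAt d Lc (toSite r) cE cVH cΛ j)) (unitM (sfStep Lc j) (smStep d Lc j) (M1At d Lc (toSite r) cΛ j))
            (W2SymOfK (unitK (sfStep Lc j) (smStep d Lc j) (KInvStep (d := d) Lc j)) Lc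
              (unitS (sfStep Lc j) (smStep d Lc j) (SpureRecAt d Lc (toSite r) cE cVH cΛ j)) (unitM (sfStep Lc j) (smStep d Lc j) (M1At d Lc (toSite r) cΛ j)) 0
              (unitM₂ (sfStep Lc j) (smStep d Lc j) (M2Of d Lc (mixFFAt (toSite r) Lc) j))) κ u κ' u') + cB • vh₂S κ u κ' u'))
        μ ν (Sum.inl α) (Sum.inl β)
      = zmode N (fun κ u κ' u' => (cE₂ * (Lc : ℝ) ^ (2 * (d + 1))) • mmRead Lc (K3OfK
            (unitK (sfStep Lc j) (smStep d Lc j) (KInvStep (d := d) Lc j)) Lc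
            (unitS (sfStep Lc j) (smStep d Lc j) (SpureRecAt d Lc (toSite r) cE cVH cΛ j)) (unitM (sfStep Lc j) (smStep d Lc j) (M1At d Lc (toSite r) cΛ j))
            (W2SymOfK (unitK (sfStep Lc j) (smStep d Lc j) (KInvStep (d := d) Lc j)) Lc
              (unitS (sfStep Lc j) (smStep d Lc j) (SpureRecAt d Lc (toSite r) cE cVH cΛ j)) (unitM (sfStep Lc j) (smStep d Lc j) (M1At d Lc (toSite r) cΛ j)) 0
              (unitM₂ (sfStep Lc j) (smStep d Lc j) (M2Of d Lc (mixFFAt (toSite r) Lc) j))) κ u κ' u') + cB • vh₂S κ u κ' u')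
          μ ν (Sum.inl α) (Sum.inl β)
        + ((N : ℝ) ^ (d + 1)) * ((cE₂ * (Lc : ℝ) ^ (2 * (d + 1))) * ((1 / 2 : ℝ) * (((Lc : ℝ) ^ (d + 1 + 1))⁻¹) ^ 4) *
          (zmode Lc X μ ν (Sum.inl α) (Sum.inl β) + zmode Lc X ν μ (Sum.inl α) (Sum.inl β))) := by
  obtain ⟨Cb, δb, hδb, hb⟩ := shape_sourceB hLc hr cE cVH cΛ cE₂ cB Tc hBff hBmm hB j
  obtain ⟨m, CK, hm, hCK, hK⟩ := decays_KInvStep (d := d) (Lc := Lc) j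
  have hA := locStencil₂_lin4 (decays_unitK (sf := sfStep Lc j) (sm := smStep d Lc j) hK) (by positivity) hm hLc
    (cE₂ * (Lc : ℝ) ^ (2 * (d + 1))) hX hδX
  have hr0 : 0 < min (min m δX / 128) δb := lt_min (by positivity) hδb
  rw [zmode_add (N := N) (hA.mono (min_le_left _ _)) (hb.mono (min_le_right _ _)) hr0,
    zmode_lin4_step hLc N j (cE₂ * (Lc : ℝ) ^ (2 * (d + 1))) hX hδX hXcov μ ν α β]
  ring

end Summit.QuantumFields.BalabanUV.Beta.GAN24.T2RecChargeStepMap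

end
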